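import Literature.Analysis.PDE.WeakHarnackRegularity
import Literature.Analysis.PDE.ABPEllipticBound
import HarnessLib

/-!
# The measure-to-supremum step of the weak Harnack inequality (Gilbarg–Trudinger (9.54)–(9.56))

On the unit ball `B₁` of a Euclidean space of dimension `n ≥ 1`, let `u ≥ 0` be `C²` near `B̄₁`
with `a^{ij}D_{ij}u ≤ f`, `|f| ≤ N`, `N > 0`, for symmetric coefficients `λ ≤ a ≤ Λ`. With the
barrier `v = η (-log(u+N))` and `S = max_{B̄₁} v = v(x₀) > 0`, the ABP estimate applied on
`Ω' = {v > 0} ∩ B₁` with the barrier inequality of `WeakHarnackBarrier` gives the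
**core estimate** (`barrier_core_estimate`)
`(S/2)ⁿ ω ≤ K₁ ω + K₂ Sⁿ · μ({v > 0} ∩ B₁ ∩ B_α)`, `ω = μ(B₁)`,
with explicit `K₁, K₂` depending on `n, λ, Λ, β, α` — GT's (9.54) in the "`n`-th power" form,
ready for the absorption (9.55)–(9.56).

## References

* D. Gilbarg, N. S. Trudinger, *Elliptic Partial Differential Equations of Second Order* (2001),
  proof of Theorem 9.22, (9.54). [GilbargTrudinger2001]
-/

noncomputable section

open Set InnerProductSpace RealInnerProductSpace Matrix Filter Metric MeasureTheory
open scoped Topology ENNReal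

namespace Literature.Analysis.PDE.KrylovSafonov

open Literature.Analysis.PDE.ABP

variable {E : Type*} [NormedAddCommGroup E] [InnerProductSpace ℝ E] [FiniteDimensional ℝ E]
  [MeasurableSpace E] [BorelSpace E] {ι : Type*} [Fintype ι] [DecidableEq ι]

/-- The positivity set `Ω' = {y ∈ B₁ | v(y) > 0}` of the barrier. [folklore] -/
def posSet (m : ℕ) (u : E → ℝ) (N : ℝ) : Set E := {y | y ∈ ball (0 : E) 1 ∧ 0 < barrier m u N y}

omit [InnerProductSpace ℝ E] [FiniteDimensional ℝ E] [MeasurableSpace E] [BorelSpace E] in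
/-- `Ω'` is open. [folklore] -/
theorem isOpen_posSet {m : ℕ} {u : E → ℝ} {N : ℝ} (hu : ContinuousOn u (closedBall (0 : E) 1))
    (hpos : ∀ y ∈ closedBall (0 : E) 1, 0 < u y + N) : IsOpen (posSet m u N) := by
  have h := ((continuousOn_barrier (m := m) hu hpos).mono ball_subset_closedBall).isOpen_inter_preimage
    isOpen_ball (isOpen_Ioi (a := (0 : ℝ)))
  exact h

omit [InnerProductSpace ℝ E] [FiniteDimensional ℝ E] [MeasurableSpace E] [BorelSpace E] in
/-- `Ω' ⊆ B₁`. [folklore] -/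
theorem posSet_subset (m : ℕ) (u : E → ℝ) (N : ℝ) : posSet m u N ⊆ ball (0 : E) 1 := fun _ hy ↦ hy.1

/-- **The core estimate (GT (9.54), `n`-th power form).** With `S = v(x₀) = max_{B̄₁} v > 0`:
`(S/2)ⁿ ω ≤ 2ⁿ((A+1)/(nλ))ⁿ ω + 2ⁿ(c/(nλ))ⁿ Sⁿ μ(Ω' ∩ B_α)`, where `A = 4β²Λ`,
`c = 2βnΛ/(1-α²)`, `β = m+2`, `ω = μ(B₁)`. [cite: GilbargTrudinger2001, proof of Thm 9.22, (9.54)] -/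
theorem barrier_core_estimate [Nonempty ι] (μ : Measure E) [μ.IsAddHaarMeasure]
    (b : OrthonormalBasis ι ℝ E) {U : Set E} (hU : IsOpen U) (hBU : closedBall (0 : E) 1 ⊆ U)
    {u f : E → ℝ} {N : ℝ} (hu : ContDiffOn ℝ 2 u U) (hu0 : ∀ y ∈ closedBall (0 : E) 1, 0 ≤ u y)
    (hN : 0 < N) (hf : ∀ y ∈ ball (0 : E) 1, |f y| ≤ N)
    {a : E → Matrix ι ι ℝ} (ha : ∀ y ∈ ball (0 : E) 1, (a y).IsSymm) {lam Λ : ℝ} (hlam0 : 0 < lam)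
    (hΛ0 : 0 ≤ Λ) (hlam : ∀ y ∈ ball (0 : E) 1, ∀ ξ : ι → ℝ, lam * (ξ ⬝ᵥ ξ) ≤ ξ ⬝ᵥ (a y *ᵥ ξ))
    (hΛ : ∀ y ∈ ball (0 : E) 1, ∀ ξ : ι → ℝ, ξ ⬝ᵥ (a y *ᵥ ξ) ≤ Λ * (ξ ⬝ᵥ ξ))
    (hsuper : ∀ y ∈ ball (0 : E) 1, pair (a y) (hessianMatrix u b y) ≤ f y)
    {m : ℕ} {α : ℝ} (hα0 : 0 < α) (hα1 : α ^ 2 < 1)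
    (hβl : Fintype.card ι * Λ ≤ 2 * (((m + 2 : ℕ) : ℝ) - 1) * lam * α ^ 2)
    {x₀ : E} (hx₀ : x₀ ∈ closedBall (0 : E) 1) (hmax : IsMaxOn (barrier m u N) (closedBall 0 1) x₀)
    (hS : 0 < barrier m u N x₀) :
    ENNReal.ofReal ((barrier m u N x₀ / 2) ^ Fintype.card ι) * μ (ball (0 : E) 1) ≤
      ENNReal.ofReal (2 ^ Fintype.card ι *
          ((4 * ((m + 2 : ℕ) : ℝ) ^ 2 * Λ + 1) / (Fintype.card ι * lam)) ^ Fintype.card ι) *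
        μ (ball (0 : E) 1) +
      ENNReal.ofReal (2 ^ Fintype.card ι *
          ((2 * ((m + 2 : ℕ) : ℝ) * (Fintype.card ι * Λ) / (1 - α ^ 2)) / (Fintype.card ι * lam)) ^
            Fintype.card ι * (barrier m u N x₀) ^ Fintype.card ι) *
        μ (posSet m u N ∩ ball (0 : E) α) := by
  haveI : CompleteSpace E := FiniteDimensional.complete ℝ E
  haveI : Nontrivial E := by
    obtain ⟨i⟩ := ‹Nonempty ι›
    exact ⟨⟨b i, 0, fun h ↦ by simpa [h] using b.orthonormal.1 i⟩⟩
  set n := Fintype.card ι with hn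
  set v := barrier m u N with hvdef
  set S := v x₀ with hSdef
  set Ω' := posSet m u N with hΩ'
  set A : ℝ := 4 * ((m + 2 : ℕ) : ℝ) ^ 2 * Λ with hA
  set cc : ℝ := 2 * ((m + 2 : ℕ) : ℝ) * (n * Λ) / (1 - α ^ 2) with hcc
  have hpos : ∀ y ∈ closedBall (0 : E) 1, 0 < u y + N := fun y hy ↦ by
    linarith [hu0 y hy]
  have hcu : ContinuousOn u (closedBall (0 : E) 1) := hu.continuousOn.mono hBU
  have hΩo : IsOpen Ω' := isOpen_posSet hcu hpos
  have hΩB : Ω' ⊆ ball (0 : E) 1 := posSet_subset m u N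
  have hΩb : Bornology.IsBounded Ω' := isBounded_ball.subset hΩB
  have hclΩ : closure Ω' ⊆ closedBall (0 : E) 1 :=
    (closure_mono hΩB).trans (closure_ball_subset_closedBall)
  -- `x₀ ∈ Ω'` (since `v = 0` on the sphere)
  have hx₀B : x₀ ∈ ball (0 : E) 1 := by
    have h1 : ‖x₀‖ ≤ 1 := mem_closedBall_zero_iff.1 hx₀
    rcases h1.lt_or_eq with h | h
    · exact mem_ball_zero_iff.2 h
    · exact absurd (barrier_eq_zero_of_norm_eq_one (m := m) (u := u) (N := N) h) hS.ne'
  have hx₀Ω : x₀ ∈ Ω' := ⟨hx₀B, hS⟩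
  -- regularity inputs for ABP
  have hvc : ContinuousOn v (closure Ω') := (continuousOn_barrier hcu hpos).mono hclΩ
  have hdiff : ∀ y ∈ Ω', DifferentiableAt ℝ v y := fun y hy ↦
    differentiableAt_barrier hU hBU hu hpos (mem_ball_zero_iff.1 (hΩB hy))
  have hgu : ContinuousOn (gradient v) Ω' :=
    (continuousOn_gradient_barrier hU hBU hu hpos).mono hΩB
  have hD2f : ∀ y ∈ Ω', DifferentiableAt ℝ (fderiv ℝ v) y := fun y hy ↦
    differentiableAt_fderiv_barrier hU hBU hu hpos (mem_ball_zero_iff.1 (hΩB hy))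
  have hsymm : ∀ y ∈ Ω', ∀ v₁ v₂, fderiv ℝ (fderiv ℝ v) y v₁ v₂ = fderiv ℝ (fderiv ℝ v) y v₂ v₁ :=
    fun y hy v₁ v₂ ↦ fderiv_fderiv_barrier_symm hU hBU hu hpos (mem_ball_zero_iff.1 (hΩB hy)) v₁ v₂
  have hbd : ∀ y ∈ frontier Ω', v y ≤ 0 := by
    intro y hy
    have hycl : y ∈ closure Ω' := frontier_subset_closure hy
    have hyint : y ∉ Ω' := by
      have : y ∉ interior Ω' := hy.2
      rwa [hΩo.interior_eq] at this
    have hy1 : ‖y‖ ≤ 1 := mem_closedBall_zero_iff.1 (hclΩ hycl)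
    rcases hy1.lt_or_eq with h | h
    · by_contra hvy
      push Not at hvy
      exact hyint ⟨mem_ball_zero_iff.2 h, hvy⟩
    · exact (barrier_eq_zero_of_norm_eq_one h).le
  -- the diameter of `Ω'`
  have hd2 : diam (closure Ω') ≤ 2 :=
    (diam_mono hclΩ isBounded_closedBall).trans (by simpa using diam_closedBall (x := (0 : E)) zero_le_one)
  have hd : 0 < diam (closure Ω') := by
    obtain ⟨r, hr, hrΩ⟩ := Metric.isOpen_iff.1 hΩo x₀ hx₀Ω
    obtain ⟨i⟩ := ‹Nonempty ι›
    have hbi : ‖b i‖ = 1 := b.orthonormal.1 i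
    set y := x₀ + (r / 2) • b i with hy
    have hyΩ : y ∈ Ω' := hrΩ (by
      rw [mem_ball, hy, dist_eq_norm, add_sub_cancel_left, norm_smul, hbi, mul_one,
        Real.norm_of_nonneg (by positivity)]
      linarith)
    have hdist : dist y x₀ = r / 2 := by
      rw [hy, dist_eq_norm, add_sub_cancel_left, norm_smul, hbi, mul_one,
        Real.norm_of_nonneg (by positivity)]
    have := dist_le_diam_of_mem (hΩb.closure) (subset_closure hyΩ) (subset_closure hx₀Ω)
    linarith
  -- coefficients
  have haH : ∀ y ∈ Ω', (a y).IsHermitian := fun y hy ↦ by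
    rw [IsHermitian, conjTranspose_eq_transpose_of_trivial]; exact ha y (hΩB hy)
  have hell : ∀ y ∈ Ω', ∀ ξ : ι → ℝ, lam * (ξ ⬝ᵥ ξ) ≤ ξ ⬝ᵥ (a y *ᵥ ξ) :=
    fun y hy ↦ hlam y (hΩB hy)
  -- the majorant `F`
  set F : E → ℝ := fun y ↦ A + max (f y / (u y + N)) 0 +
    (if ‖y‖ ^ 2 < α ^ 2 then cc * v y else 0) with hF
  have hFineq : ∀ y ∈ Ω', -∑ i, ∑ j, a y i j * hessianMatrix v b y i j ≤ F y := by
    intro y hy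
    have hy1 : ‖y‖ < 1 := mem_ball_zero_iff.1 (hΩB hy)
    have hev := eventually_differentiableAt_pos hU hBU hu hpos hu.continuousOn hy1
    have hyU : y ∈ U := hBU (ball_subset_closedBall (hΩB hy))
    have h := neg_pair_hessianMatrix_barrier_le b hy1 hev
      (differentiableAt_fderiv_of_contDiffOn hU hu hyU) (ha y (hΩB hy)) hlam0 hΛ0
      (hlam y (hΩB hy)) (hΛ y (hΩB hy)) (hsuper y (hΩB hy)) hα1 hβl hy.2
    exact h
  -- ABP
  have habp := addHaar_ball_le_lintegral_elliptic μ hΩo hΩb hvc hdiff hgu hD2f hsymm hbd hx₀Ω hd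
    b haH hlam0 hell hFineq
  -- lower bound of the left side: `ball 0 (S/2) ⊆ ball 0 (S/d)`
  have hfin : Module.finrank ℝ E = n := by rw [hn, Module.finrank_eq_card_basis b.toBasis]
  have hL : ENNReal.ofReal ((S / 2) ^ n) * μ (ball (0 : E) 1) ≤
      μ (ball (0 : E) (v x₀ / diam (closure Ω'))) := by
    rw [← hfin, ← Measure.addHaar_ball μ (0 : E) (by positivity : 0 ≤ S / 2)]
    refine measure_mono (ball_subset_ball ?_)
    rw [hSdef]
    exact div_le_div_of_nonneg_left hS.le hd hd2
  -- elementary: `(x + y)ⁿ ≤ 2ⁿ (xⁿ + yⁿ)` for `x, y ≥ 0`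
  have add_pow_le : ∀ {x y : ℝ}, 0 ≤ x → 0 ≤ y → (x + y) ^ n ≤ 2 ^ n * (x ^ n + y ^ n) := by
    intro x y hx hy
    have h : x + y ≤ 2 * max x y := by
      rcases le_total x y with h | h
      · rw [max_eq_right h]; linarith
      · rw [max_eq_left h]; linarith
    calc (x + y) ^ n ≤ (2 * max x y) ^ n := pow_le_pow_left₀ (by positivity) h n
      _ = 2 ^ n * (max x y) ^ n := by rw [mul_pow]
      _ ≤ 2 ^ n * (x ^ n + y ^ n) := by
          refine mul_le_mul_of_nonneg_left ?_ (by positivity)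
          rcases le_total x y with h | h
          · rw [max_eq_right h]; linarith [pow_nonneg hx n]
          · rw [max_eq_left h]; linarith [pow_nonneg hy n]
  -- upper bound of the right side, pointwise on `Ω'`
  set K₁ : ℝ := 2 ^ n * ((A + 1) / (n * lam)) ^ n with hK₁
  set K₂ : ℝ := 2 ^ n * (cc / (n * lam)) ^ n * S ^ n with hK₂
  have hnlam : 0 < (n : ℝ) * lam := by
    have : 0 < (n : ℝ) := by exact_mod_cast Fintype.card_pos
    positivity
  have hcc0 : 0 ≤ cc := by
    rw [hcc]; exact div_nonneg (by positivity) (by linarith)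
  have hA0 : 0 ≤ A := by positivity
  have hptw : ∀ y ∈ Ω', ENNReal.ofReal ((F y / (n * lam)) ^ n) ≤
      ENNReal.ofReal K₁ + (ball (0 : E) α).indicator (fun _ ↦ ENNReal.ofReal K₂) y := by
    intro y hy
    have hyB := hΩB hy
    have hvy : 0 < v y := hy.2
    have hvS : v y ≤ S := hmax (ball_subset_closedBall hyB)
    -- `max (f/ū) 0 ≤ 1`
    have hg1 : max (f y / (u y + N)) 0 ≤ 1 := by
      refine max_le ?_ zero_le_one
      have hū : N ≤ u y + N := by linarith [hu0 y (ball_subset_closedBall hyB)]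
      have hūpos : 0 < u y + N := hpos y (ball_subset_closedBall hyB)
      rw [div_le_one hūpos]
      exact ((le_abs_self _).trans (hf y hyB)).trans hū
    by_cases hcase : ‖y‖ ^ 2 < α ^ 2
    · -- inside `B_α`
      have hyα : y ∈ ball (0 : E) α := by
        rw [mem_ball_zero_iff]
        exact lt_of_pow_lt_pow_left₀ 2 hα0.le hcase
      rw [indicator_of_mem hyα, ← ENNReal.ofReal_add (by positivity) (by positivity)]
      refine ENNReal.ofReal_le_ofReal ?_
      have hFy : F y = A + max (f y / (u y + N)) 0 + cc * v y := by rw [hF]; simp [hcase]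
      have hF0 : 0 ≤ F y := by rw [hFy]; positivity
      have hFle : F y / (n * lam) ≤ (A + 1) / (n * lam) + cc / (n * lam) * S := by
        rw [div_mul_eq_mul_div, ← add_div]; refine div_le_div_of_nonneg_right ?_ hnlam.le
        rw [hFy]; nlinarith [mul_le_mul_of_nonneg_left hvS hcc0]
      calc (F y / (n * lam)) ^ n ≤ ((A + 1) / (n * lam) + cc / (n * lam) * S) ^ n :=
            pow_le_pow_left₀ (div_nonneg hF0 hnlam.le) hFle n
        _ ≤ 2 ^ n * (((A + 1) / (n * lam)) ^ n + (cc / (n * lam) * S) ^ n) :=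
            add_pow_le (by positivity) (mul_nonneg (div_nonneg hcc0 hnlam.le) hS.le)
        _ = K₁ + K₂ := by rw [hK₁, hK₂, mul_pow]; ring
    · by_cases hyα : y ∈ ball (0 : E) α
      · -- also fine: bound by `K₁ + K₂ ≥ K₁`
        rw [indicator_of_mem hyα, ← ENNReal.ofReal_add (by positivity) (by positivity)]
        refine ENNReal.ofReal_le_ofReal ?_
        have hFy : F y = A + max (f y / (u y + N)) 0 := by rw [hF]; simp [hcase]
        have hF0 : 0 ≤ F y := by rw [hFy]; positivity
        calc (F y / (n * lam)) ^ n ≤ ((A + 1) / (n * lam)) ^ n :=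
              pow_le_pow_left₀ (div_nonneg hF0 hnlam.le)
                (div_le_div_of_nonneg_right (by rw [hFy]; linarith) hnlam.le) n
          _ ≤ K₁ + K₂ := by
              have h1 : ((A + 1) / (n * lam)) ^ n ≤ K₁ := by
                rw [hK₁]
                have : (1 : ℝ) ≤ 2 ^ n := one_le_pow₀ (by norm_num)
                nlinarith [pow_nonneg (div_nonneg (by positivity : (0:ℝ) ≤ A + 1) hnlam.le) n]
              have h2 : 0 ≤ K₂ := by positivity
              linarith
      · rw [indicator_of_notMem hyα, add_zero]
        refine ENNReal.ofReal_le_ofReal ?_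
        have hFy : F y = A + max (f y / (u y + N)) 0 := by rw [hF]; simp [hcase]
        have hF0 : 0 ≤ F y := by rw [hFy]; positivity
        calc (F y / (n * lam)) ^ n ≤ ((A + 1) / (n * lam)) ^ n :=
              pow_le_pow_left₀ (div_nonneg hF0 hnlam.le)
                (div_le_div_of_nonneg_right (by rw [hFy]; linarith) hnlam.le) n
          _ ≤ K₁ := by
              rw [hK₁]
              have : (1 : ℝ) ≤ 2 ^ n := one_le_pow₀ (by norm_num)
              nlinarith [pow_nonneg (div_nonneg (by positivity : (0:ℝ) ≤ A + 1) hnlam.le) n]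
  have hR : ∫⁻ y in Ω', ENNReal.ofReal ((F y / (n * lam)) ^ n) ∂μ ≤
      ENNReal.ofReal K₁ * μ (ball (0 : E) 1) + ENNReal.ofReal K₂ * μ (Ω' ∩ ball (0 : E) α) := by
    calc ∫⁻ y in Ω', ENNReal.ofReal ((F y / (n * lam)) ^ n) ∂μ
        ≤ ∫⁻ y in Ω', (ENNReal.ofReal K₁ + (ball (0 : E) α).indicator (fun _ ↦ ENNReal.ofReal K₂) y) ∂μ :=
          setLIntegral_mono' hΩo.measurableSet hptw
      _ = ENNReal.ofReal K₁ * μ Ω' + ENNReal.ofReal K₂ * μ (ball (0 : E) α ∩ Ω') := by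
          rw [lintegral_add_left measurable_const, setLIntegral_const,
            setLIntegral_indicator measurableSet_ball, setLIntegral_const]
      _ ≤ ENNReal.ofReal K₁ * μ (ball (0 : E) 1) + ENNReal.ofReal K₂ * μ (Ω' ∩ ball (0 : E) α) := by
          rw [inter_comm]
          exact add_le_add (mul_le_mul_right (measure_mono hΩB) _) le_rfl
  have hfinal := (hL.trans habp).trans hR
  rw [hK₁, hK₂] at hfinal
  exact hfinal

end Literature.Analysis.PDE.KrylovSafonov

end
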